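import Literature.MathematicalPhysics.KineticTheory.QuarticRingChain
import Literature.MathematicalPhysics.KineticTheory.LangevinSemigroup
import Literature.MathematicalPhysics.KineticTheory.LangevinChainNESS
import HarnessLib

/-!
# Non-equilibrium steady states of the Langevin-driven purely quartic chain (named facts)

Topic `Literature/MathematicalPhysics/KineticTheory`. Named facts (sorry-free `def … : Prop`, taken
as hypotheses `(h : FactName)`) recording that the printed existence-and-uniqueness theory of the
non-equilibrium steady state, Cuneo–Eckmann–Hairer–Rey-Bellet 2018, Theorem 2.13, covers the
PURELY QUARTIC chain `pureQuarticChain μ γ = ⟨U = μ q⁴/4, V = r⁴/4, γ⟩` of `QuarticRingChain.lean`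
(the scale-free "anchor" of the `FouriersLaw` family: quartic pinning AND quartic coupling, no
harmonic parts), exactly as `LangevinSemigroup.lean` / `LangevinChainNESS.lean` record it for
`pinnedChain ω₂ lam β γ`. Wanted by the anchor routes of `AtomisticToContinuum/FouriersLaw`
(grounds the existence half of `Summit.AtomisticToContinuum.FouriersLaw.Theses.PorousMediumCorner.AnchorNess`,
whose decl inlines the chain as `OscillatorChain.mk (fun q => μ * q ^ 4 / 4) (fun r => r ^ 4 / 4) γ`
— definitionally `pureQuarticChain μ γ`, `pureQuarticChain_eq_mk`; the same statement was the
items AnchorNess / AnchorSteadyStateExists of the retired routes AffineAnchor / ScaleFreeQuarticAnchor).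

## Source and the verification of its hypotheses for this chain

Cuneo–Eckmann–Hairer–Rey-Bellet, *Non-equilibrium steady states for networks of oscillators*,
Electron. J. Probab. 23 (2018) no. 55, arXiv:1712.09413, Theorem 2.13 (quoted in full in the
docstring of `CuneoEckmannHairerReyBellet2018_thm213`, `LangevinSemigroup.lean`). Their system
(2.2) with the path graph `{0,…,N-1}`, baths `B = {0, N-1}`, `γ_b = γ`, `n = 1` has generator
(3.2) `= OscillatorChain.generator (pureQuarticChain μ γ) N T_L T_R`. Conditions, read on the
materialised arXiv text (§2.1–§2.4):
* C1 (Def. 2.1, Remark 2.2: "Chains with heat baths at both ends (or even at just one end)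
  obviously satisfy C1"); for `N = 1` both bath terms act on the single site (one bath, friction
  `2γ`, temperature `(T_L+T_R)/2 ≤ T_max`).
* C2 (Def. 2.4: `{D^α ∇V(x) : 1 ≤ |α| ≤ ℓ}` spans `ℝⁿ` at every `x`), by their Example 2.5
  VERBATIM: "Any potential of the form `V(x) = ‖x‖^r` with `r = 2, 4, 6, …` is non-degenerate" —
  here `V = r⁴/4`, `V'''' = 6 ≠ 0` (`ℓ = 3`), although `V''(0) = 0`. (So the non-degeneracy used
  by the tree's PROOF for `pinnedChain`, `V'' = 1 + 3βr² ≥ 1`, is not available: that proof —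
  `LangevinChainH2Proof` / `LangevinChainHormander` / `LangevinChainKernelDensity` — does not
  transfer verbatim; the printed theorem does.)
* C3 (Def. 2.7, Example 2.8: "`V(x) = ‖x‖^r` with `r = 2, 4, 6, …` is nearly homogeneous"):
  `U = μq⁴/4` (`μ > 0`) and `V = r⁴/4` are homogeneous of degree `ℓ_p = ℓ_i = 4`, coercive.
* C4 (Remark 2.10: automatic for `n = 1`).
* C5 (`ℓ_i = 4 ≥ ℓ_p = 4`).
Hence Theorem 2.13 (1)–(3) applies to `pureQuarticChain μ γ`, `μ, γ > 0`, `N ≥ 1`, `T_L, T_R > 0`.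

## What is vendored, and what is NOT

* `CuneoEckmannHairerReyBellet2018_thm213_pureQuartic` — Theorem 2.13 (1)–(3) for this chain,
  packaged EXISTENTIALLY over the interface `LangevinChainSemigroup` exactly as
  `CuneoEckmannHairerReyBellet2018_thm213` is for `pinnedChain` (see the design notes there:
  `∃ S`, not `∀ S`; the misprint `0 < ϑ < T_max` in (2.5) read as `0 < ϑ < 1/T_max`).
* `CuneoEckmannHairerReyBellet2018_pureQuarticChain` — the WEAK-STATIONARITY COROLLARY (twin of
  `CuneoEckmannHairerReyBellet2018_pinnedChain`): for `N ≥ 1`, `T_L, T_R > 0` there is a weak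
  (Fokker–Planck) steady state `IsSteadyState` (Itô/Dynkin identity integrated against the
  invariant measure `μ⋆`; polynomial bond currents are integrable since `e^{ϑH} ∈ L¹(μ⋆)`), which is
  absolutely continuous and integrates `e^{ϑH}`, `0 < ϑ < 1/max(T_L,T_R)`.
* NOT vendored: UNIQUENESS in the class `IsSteadyState` (all weak stationary probability solutions
  of `L*μ = 0` with integrable currents) — printed uniqueness is among invariant measures of the
  semigroup; the identification "weak FPK stationary probability solution ⇒ `P_t`-invariant" for
  this hypoelliptic operator with cubic drift is the same unprinted step recorded for `pinnedChain`
  in `LangevinChainNESS.lean` (route item NessUnique). NOT vendored: finite-volume Kubo formula /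
  linear response (see `OscillatorChain.KuboFormula`).
-/

noncomputable section

open MeasureTheory
open scoped NNReal

namespace Literature.MathematicalPhysics.KineticTheory.HeatConduction

/-- NAMED FACT — **Cuneo–Eckmann–Hairer–Rey-Bellet 2018, Theorem 2.13, for the purely quartic
chain** `pureQuarticChain μ γ` (`U(q) = μq⁴/4`, `V(r) = r⁴/4`) with `μ, γ > 0`, `N ≥ 1` sites and
bath temperatures `T_L, T_R > 0`, which satisfies their Conditions C1–C5 (chain with baths at both
ends, Remark 2.2; `V = r⁴/4` non-degenerate by Example 2.5 — `‖x‖^r`, `r = 2, 4, 6, …`; `U, V`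
homogeneous of degree `ℓ_p = ℓ_i = 4` and coercive, Example 2.8; C4 automatic for `n = 1`,
Remark 2.10; `ℓ_i ≥ ℓ_p`). Printed: "1. Under Conditions C1, C2 and CA, the system (2.2) admits
at most one invariant measure, and if it exists, it has a smooth density with respect to Lebesgue
measure. 2. Under Conditions C1, C3, C4 and C5, the system (2.2) admits a least one invariant
measure, and `e^{ϑH}` is integrable with respect to it for all `0 < ϑ < 1/T_max`, with
`T_max = max{T_b : b ∈ B}`. 3. Finally, assuming Conditions C1–C5, the system (2.2) admits a
unique invariant measure `μ⋆`. Moreover, for all `0 < ϑ < [1/]T_max`, there are constants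
`C, c > 0` such that for every initial condition `z = (p, q) ∈ Ω` and all `t ≥ 0`,
`sup_{f ∈ C(Ω) : |f| ≤ e^{ϑH}} |E_z f(z_t) - ∫ f dμ⋆| ≤ C e^{ϑH(z) - ct}` (2.5)."
Vendored EXISTENTIALLY over the interface `LangevinChainSemigroup` (as
`CuneoEckmannHairerReyBellet2018_thm213` for the pinned chain): there is a Markov semigroup `S`
of the chain with (1) at most one invariant probability measure, each having a smooth density,
(2) an invariant probability measure `μ⋆` integrating `e^{ϑH}`, and (3) the bound (2.5) for
`P_t f(z) = S.act t f z`. Users take `(h : CuneoEckmannHairerReyBellet2018_thm213_pureQuartic)`.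
[cite: CuneoEckmannHairerReyBellet2018, Thm 2.13] -/
def CuneoEckmannHairerReyBellet2018_thm213_pureQuartic : Prop :=
  ∀ μ γ : ℝ, 0 < μ → 0 < γ →
    ∀ (N : ℕ) (T_L T_R : ℝ), 0 < N → 0 < T_L → 0 < T_R →
      ∃ S : LangevinChainSemigroup (pureQuarticChain μ γ) N T_L T_R,
        -- (1) at most one invariant probability measure, and it has a smooth density
        (∀ m m' : Measure (PhaseSpace N), IsProbabilityMeasure m → IsProbabilityMeasure m' →
            S.IsInvariant m → S.IsInvariant m' → m = m') ∧
        (∀ m : Measure (PhaseSpace N), IsProbabilityMeasure m → S.IsInvariant m →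
            HasSmoothDensity m) ∧
        -- (2)–(3) existence of `μ⋆`, integrability of `e^{ϑH}`, exponential convergence (2.5)
        ∃ ms : Measure (PhaseSpace N), IsProbabilityMeasure ms ∧ S.IsInvariant ms ∧
          ∀ ϑ : ℝ, 0 < ϑ → ϑ < 1 / max T_L T_R →
            Integrable (fun z => Real.exp (ϑ * (pureQuarticChain μ γ).hamiltonian N z)) ms ∧
            ∃ C c : ℝ, 0 < C ∧ 0 < c ∧
              ∀ (z : PhaseSpace N) (t : ℝ≥0) (f : PhaseSpace N → ℝ), Continuous f →
                (∀ y, |f y| ≤ Real.exp (ϑ * (pureQuarticChain μ γ).hamiltonian N y)) →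
                |S.act t f z - ∫ y, f y ∂ms| ≤
                  C * Real.exp (ϑ * (pureQuarticChain μ γ).hamiltonian N z) * Real.exp (-c * t)

/-- NAMED FACT — **Cuneo–Eckmann–Hairer–Rey-Bellet 2018, Theorem 2.13 (weak-stationarity
corollary), for the purely quartic chain** `pureQuarticChain μ γ` (`U(q) = μq⁴/4`, `V(r) = r⁴/4`)
with `μ, γ > 0`, every length `N ≥ 1` and all bath temperatures `T_L, T_R > 0`: there is a
probability measure on phase space which (i) is a steady state in the weak Fokker–Planck sense of
`OscillatorChain.IsSteadyState` (`∫ L f dμ = 0` for all smooth compactly supported `f`, bond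
currents integrable), (ii) is absolutely continuous with respect to Lebesgue measure ("it has a
smooth density with respect to Lebesgue measure"), and (iii) integrates `e^{ϑH}` for every
`0 < ϑ < 1/max(T_L, T_R)`. Printed for the unique invariant measure `μ⋆` of the Langevin system
(2.2) under C1–C5, which this chain satisfies (Remark 2.2; Example 2.5: `‖x‖⁴` is non-degenerate
although `V''(0) = 0`; Example 2.8; Remark 2.10; `ℓ_i = ℓ_p = 4`); the weak stationarity of `μ⋆`
is the Itô/Dynkin identity `∫ (P_t f - f) dμ⋆ = ∫₀ᵗ ∫ P_s(Lf) dμ⋆ ds = 0`, and the polynomial bond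
currents are dominated by `C e^{ϑH}`. Twin of `CuneoEckmannHairerReyBellet2018_pinnedChain`;
UNIQUENESS in the class `IsSteadyState` is NOT part of this fact (module docstring).
[cite: CuneoEckmannHairerReyBellet2018, Thm 2.13] -/
def CuneoEckmannHairerReyBellet2018_pureQuarticChain : Prop :=
  ∀ μ γ : ℝ, 0 < μ → 0 < γ →
    ∀ (N : ℕ) (T_L T_R : ℝ), 0 < N → 0 < T_L → 0 < T_R →
      ∃ m : Measure (PhaseSpace N),
        (pureQuarticChain μ γ).IsSteadyState N T_L T_R m ∧
        m ≪ (volume : Measure (PhaseSpace N)) ∧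
        ∀ ϑ : ℝ, 0 < ϑ → ϑ < 1 / max T_L T_R →
          Integrable (fun x => Real.exp (ϑ * (pureQuarticChain μ γ).hamiltonian N x)) m

/-! ### Corollaries (proved from the facts) -/

/-- Unfolding: the weak-stationarity fact yields a weak steady state of the purely quartic chain
for every `N ≥ 1`. [folklore] -/
theorem CuneoEckmannHairerReyBellet2018_pureQuarticChain.exists_isSteadyState
    (h : CuneoEckmannHairerReyBellet2018_pureQuarticChain) {μ γ : ℝ} (hμ : 0 < μ) (hγ : 0 < γ)
    {N : ℕ} (hN : 0 < N) {T_L T_R : ℝ} (hL : 0 < T_L) (hR : 0 < T_R) :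
    ∃ m : Measure (PhaseSpace N), (pureQuarticChain μ γ).IsSteadyState N T_L T_R m := by
  obtain ⟨m, hm, -, -⟩ := h μ γ hμ hγ N T_L T_R hN hL hR
  exact ⟨m, hm⟩

/-- Hence a weak steady state of the purely quartic chain at EVERY length, `N = 0` included (the
empty chain carries the point mass, `OscillatorChain.isSteadyState_zero`), stated for the inline
anonymous-constructor form `⟨fun q => μ * q ^ 4 / 4, fun r => r ^ 4 / 4, γ⟩` used verbatim by the
route items (definitionally `pureQuarticChain μ γ`, `pureQuarticChain_eq_mk`) — the existence
half of `PorousMediumCorner.AnchorNess`. [folklore] -/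
theorem CuneoEckmannHairerReyBellet2018_pureQuarticChain.exists_isSteadyState_mk
    (h : CuneoEckmannHairerReyBellet2018_pureQuarticChain) {μ γ : ℝ} (hμ : 0 < μ) (hγ : 0 < γ)
    (N : ℕ) {T_L T_R : ℝ} (hL : 0 < T_L) (hR : 0 < T_R) :
    ∃ m : Measure (PhaseSpace N),
      (OscillatorChain.mk (fun q => μ * q ^ 4 / 4) (fun r => r ^ 4 / 4) γ).IsSteadyState
        N T_L T_R m := by
  rw [← pureQuarticChain_eq_mk]
  rcases Nat.eq_zero_or_pos N with rfl | hN
  · exact ⟨_, OscillatorChain.isSteadyState_zero _ T_L T_R⟩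
  · exact h.exists_isSteadyState hμ hγ hN hL hR

/-- The purely quartic Hamiltonian is nonnegative when `μ ≥ 0` (all terms are even powers with
nonnegative coefficients); needed to specialise (2.5) to bounded observables (`|f| ≤ 1 ≤ e^{ϑH}`).
[folklore] -/
theorem pureQuarticChain_hamiltonian_nonneg {μ : ℝ} (hμ : 0 ≤ μ) (γ : ℝ) (N : ℕ)
    (z : PhaseSpace N) : 0 ≤ (pureQuarticChain μ γ).hamiltonian N z := by
  unfold OscillatorChain.hamiltonian pureQuarticChain
  refine add_nonneg (Finset.sum_nonneg fun i _ => ?_)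
    (Finset.sum_nonneg fun i _ => Finset.sum_nonneg fun j _ => ?_)
  · positivity
  · split_ifs
    · positivity
    · exact le_rfl

namespace CuneoEckmannHairerReyBellet2018_thm213_pureQuartic

variable (h : CuneoEckmannHairerReyBellet2018_thm213_pureQuartic) {μ γ : ℝ}
  (hμ : 0 < μ) (hγ : 0 < γ) {N : ℕ} (hN : 0 < N) {T_L T_R : ℝ} (hL : 0 < T_L) (hR : 0 < T_R)
include h hμ hγ hN hL hR

/-- Thm 2.13 (3), first half, purely quartic chain: there is a Markov semigroup of the chain with
exactly one invariant probability measure. [cite: CuneoEckmannHairerReyBellet2018, Thm 2.13] -/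
theorem existsUnique_isInvariant :
    ∃ S : LangevinChainSemigroup (pureQuarticChain μ γ) N T_L T_R,
      ∃! m : Measure (PhaseSpace N), IsProbabilityMeasure m ∧ S.IsInvariant m := by
  obtain ⟨S, huniq, -, ms, hms, hinv, -⟩ := h μ γ hμ hγ N T_L T_R hN hL hR
  exact ⟨S, ms, ⟨hms, hinv⟩, fun m ⟨hm, hmi⟩ => huniq m ms hm hms hmi hinv⟩

/-- Thm 2.13 (1)+(2), purely quartic chain: there is a Markov semigroup of the chain with an
invariant probability measure that is absolutely continuous with respect to Lebesgue measure and
integrates `e^{ϑH}` for `0 < ϑ < 1/max(T_L, T_R)`.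
[cite: CuneoEckmannHairerReyBellet2018, Thm 2.13] -/
theorem exists_isInvariant_absolutelyContinuous :
    ∃ S : LangevinChainSemigroup (pureQuarticChain μ γ) N T_L T_R,
      ∃ m : Measure (PhaseSpace N), IsProbabilityMeasure m ∧ S.IsInvariant m ∧
        m ≪ (volume : Measure (PhaseSpace N)) ∧
        ∀ ϑ : ℝ, 0 < ϑ → ϑ < 1 / max T_L T_R →
          Integrable (fun z => Real.exp (ϑ * (pureQuarticChain μ γ).hamiltonian N z)) m := by
  obtain ⟨S, -, hsmooth, ms, hms, hinv, hrest⟩ := h μ γ hμ hγ N T_L T_R hN hL hR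
  exact ⟨S, ms, hms, hinv, (hsmooth ms hms hinv).absolutelyContinuous,
    fun ϑ h0 h1 => (hrest ϑ h0 h1).1⟩

/-- Thm 2.13 (3), (2.5) specialised to bounded continuous observables for the purely quartic chain
(`|f| ≤ 1 ≤ e^{ϑH}` since `H ≥ 0`, `pureQuarticChain_hamiltonian_nonneg`):
`|P_t f(z) - μ⋆(f)| ≤ C e^{ϑH(z)} e^{-ct}`. [cite: CuneoEckmannHairerReyBellet2018, Thm 2.13 eq. (2.5)] -/
theorem exists_exponential_convergence {ϑ : ℝ} (h0 : 0 < ϑ) (h1 : ϑ < 1 / max T_L T_R) :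
    ∃ S : LangevinChainSemigroup (pureQuarticChain μ γ) N T_L T_R,
      ∃ m : Measure (PhaseSpace N), IsProbabilityMeasure m ∧ S.IsInvariant m ∧
        ∃ C c : ℝ, 0 < C ∧ 0 < c ∧
          ∀ (z : PhaseSpace N) (t : ℝ≥0) (f : PhaseSpace N → ℝ), Continuous f →
            (∀ y, |f y| ≤ 1) →
            |S.act t f z - ∫ y, f y ∂m| ≤
              C * Real.exp (ϑ * (pureQuarticChain μ γ).hamiltonian N z) * Real.exp (-c * t) := by
  obtain ⟨S, -, -, ms, hms, hinv, hrest⟩ := h μ γ hμ hγ N T_L T_R hN hL hR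
  obtain ⟨-, C, c, hC, hc, hbound⟩ := hrest ϑ h0 h1
  refine ⟨S, ms, hms, hinv, C, c, hC, hc, fun z t f hf hf1 => hbound z t f hf fun y => ?_⟩
  exact (hf1 y).trans (Real.one_le_exp (mul_nonneg h0.le
    (pureQuarticChain_hamiltonian_nonneg hμ.le γ N y)))

end CuneoEckmannHairerReyBellet2018_thm213_pureQuartic

end Literature.MathematicalPhysics.KineticTheory.HeatConduction

end
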